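import Summits.QuantumFields.YangMills.Theorems.LuscherReductionTwistedTraceScalingBOStiffTransportCore
import Summits.QuantumFields.YangMills.Theorems.LuscherReductionTwistedTraceScalingBOStiffFarKernel
import Summits.QuantumFields.YangMills.Theorems.LuscherReductionTwistedTraceScalingBTWindow
import HarnessLib

/-!
# (B-ST) (W1-4) = (L-1c), THE `hnear` GLUE: the based-averaged kernel on the tube windows is two-sided near the product `ρ(u',u)·G₁(x',x)` up to an absolute tail — β-pointwise
# (lane A of S-BASE, crux `TwistedTraceScaling` stmt-QuantumFields-20203, C4-CORE, the (B-ST) pen; HANDOFF-g21 UPDATE 20:14Z (W1-4))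

The slow ⊗ fibre assembly `…BOStiffSlowAssembly.form_le_of_product_near` wants, for all pairs `p = (u',x')`, `q = (u,x)` of its index space,
`|G p q − k p.1 q.1·M p.2 q.2| ≤ η_t·(k p.1 q.1·M p.2 q.2) + τ`.  With `G(U,V) = ∫_h K_β(U, V^{basedExt h}) dh` the FULL based-averaged kernel, `ρ(u',u) = K₁^{(L³β)}(u',u)/K₁(1,1)` and
`G₁(x',x) = G(orthoTube 1 x', orthoTube 1 x)` the FULL central based kernel (PSD, ✓`…BOStiffFibrePSD`), this file proves the inequality POINTWISE for every pair of tube points whose slow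
data lie in the window (`‖q(u_k) − 1‖ ≤ δ`, one-site actions `≤ σ/L³`) and whose fibre data lie in the core (cap, entries `≤ T`, `‖x̂‖ ≤ R`), β by β:
★★★ `basedKernel_product_near` —
  `|G(oT u' x', oT u x) − ρ·G₁(x',x)| ≤ (e^{η} − 1)·ρ·G₁(x',x) + e^{2β|E|}·(2e^{−β(T/(6L) − (2√2R+α))²} + e^{−βm₀²/L} + e^{−L³βα²})`,
`η = coreEta + coreEps1 + coreEps2` of ✓`basedKernel_core_two_sided`, `m₀ = L(1−(L−1)δ)α − 2√2LR`, for any near/far threshold `α ∈ [0,1]` with the jump budget `2√2R + α ≤ T/(6L)`, `12L(√2R+δ) ≤ 1`.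
NEAR slow pairs (`‖q(u'_k) − q(u_k)‖ ≤ α` ∀k): split `G = G_T + G_off` at the based core `C_T = {h | ‖q(h_y) − 1‖ ≤ T}` (`basedIntegral_split`); `G_T ∈ e^{±η}ρ·G₁,T` (✓`basedKernel_core_two_sided`),
`G_off, G₁,off ≤ e^{2β|E|}e^{−β(T/(6L)−b)²}` (✓`…BOStiffTransportTail.integral_basedKernel_off_core_le`), `ρ ≤ 1`.  FAR pairs (some `k` with `‖q(u'_k) − q(u_k)‖ > α`): the whole based kernel
is `≤ e^{2β|E|}e^{−βm²/L}` (✓`…BOStiffFarKernel.integral_basedKernel_far_le`, Polyakov line through the origin) and `ρ ≤ e^{−L³βα²}` (✓`…BTWindow.transferKernel_one_site_le_exp`,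
`K₁(1,1) = e^{6L³β}`).  The lead windows `G`, `k` by indicators (the test function lives in the window) and schedules `T = β^{-1/2}ℓ³`, `α = T/(12L)`, `R = r_f/2`: then `η → 0` and the
tail is `e^{2β|E|}·O(e^{−ℓ⁶/(576L)})`.
HONEST FRAMING: elementary inequalities for a stub of a child of the CONDITIONAL route R2b1; (B-ST) OPEN; C4-CORE OPEN; not infinite volume, not a gap, not Clay.
-/

set_option autoImplicit false

noncomputable section

open MeasureTheory Filter Topology Real
open scoped BigOperators
open Literature.MathematicalPhysics.QuantumFieldTheory
open Literature.MathematicalPhysics.QuantumLattice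

namespace Summit.QuantumFields.YangMills.Theorems.FemtoTransferGap.TwoLattice.ConstTube

open Summit.QuantumFields.YangMills.Theorems.FemtoTransferGap
open Summit.QuantumFields.YangMills.Theorems.FemtoTransferGap.TwoLattice
open Summit.QuantumFields.YangMills.Theorems.FemtoTransferGap.TwoLattice.Avg
open Summit.QuantumFields.YangMills.Theorems.FemtoTransferGap.TwoLattice.Stiff (LinkSpace)
open Summit.QuantumFields.YangMills.Theorems.FemtoTransferGap.TwoLattice

variable {L : ℕ} [NeZero L]

/-! ## §1 The based integral splits at the core -/

/-- The based core `C_T = {h | ∀ y, ‖q(h_y) − 1‖ ≤ T}` is measurable. [folklore] -/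
theorem measurableSet_basedCore (T : ℝ) : MeasurableSet {h : NzSite L → SU2 | ∀ y, ‖su2Quat (h y) - 1‖ ≤ T} := by
  have hq := @Literature.MathematicalPhysics.QuantumFieldTheory.Balaban1983to89.T4HaarSU2Translate.continuous_su2Quat
  have e : {h : NzSite L → SU2 | ∀ y, ‖su2Quat (h y) - 1‖ ≤ T} = ⋂ y : NzSite L, {h : NzSite L → SU2 | ‖su2Quat (h y) - 1‖ ≤ T} := by ext h; simp
  rw [e]
  exact MeasurableSet.iInter fun y => measurableSet_le (((hq.comp (continuous_apply y)).sub continuous_const).norm).measurable measurable_const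

/-- `∫ K(U, V^{bE h}) dh = ∫ 𝟙_{C_T}·K + ∫ 𝟙_{C_Tᶜ}·K`. [folklore] -/
theorem basedIntegral_split (β T : ℝ) (U V : GaugeConfig 3 L SU2) :
    ∫ h, transferKernel su2Rep β U (gaugeTransform (basedExt L h) V) ∂basedMeasure L =
      (∫ h, {h : NzSite L → SU2 | ∀ y, ‖su2Quat (h y) - 1‖ ≤ T}.indicator (fun _ => (1 : ℝ)) h * transferKernel su2Rep β U (gaugeTransform (basedExt L h) V) ∂basedMeasure L) +
        ∫ h, {h : NzSite L → SU2 | ∀ y, ‖su2Quat (h y) - 1‖ ≤ T}ᶜ.indicator (fun h => transferKernel su2Rep β U (gaugeTransform (basedExt L h) V)) h ∂basedMeasure L := by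
  haveI : SecondCountableTopology SU2 := secondCountableTopology_su2
  haveI : IsProbabilityMeasure (basedMeasure L) := by unfold basedMeasure; infer_instance
  set C := {h : NzSite L → SU2 | ∀ y, ‖su2Quat (h y) - 1‖ ≤ T} with hC
  have hCm : MeasurableSet C := measurableSet_basedCore (L := L) T
  obtain ⟨M, hM⟩ := exists_transferKernel_le su2Rep continuous_su2Rep β (L := L)
  have hKm : Measurable fun h : NzSite L → SU2 => transferKernel su2Rep β U (gaugeTransform (basedExt L h) V) :=
    (measurable_transferKernel_gaugeTransform_right β U V).comp (measurable_basedExt L)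
  have hKb : ∀ h : NzSite L → SU2, |transferKernel su2Rep β U (gaugeTransform (basedExt L h) V)| ≤ M := fun h => by
    rw [abs_of_pos (transferKernel_pos _ _ _ _)]; exact hM _ _
  have hM0 : 0 ≤ M := (abs_nonneg _).trans (hKb 1)
  have i1 : Integrable (fun h => C.indicator (fun _ => (1 : ℝ)) h * transferKernel su2Rep β U (gaugeTransform (basedExt L h) V)) (basedMeasure L) :=
    integrable_of_measurable_abs_le _ ((measurable_const.indicator hCm).mul hKm) (C := M) fun h => by
      by_cases hh : h ∈ C
      · rw [Set.indicator_of_mem hh, one_mul]; exact hKb h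
      · rw [Set.indicator_of_notMem hh, zero_mul, abs_zero]; exact hM0
  have i2 : Integrable (fun h => Cᶜ.indicator (fun h => transferKernel su2Rep β U (gaugeTransform (basedExt L h) V)) h) (basedMeasure L) :=
    integrable_of_measurable_abs_le _ (hKm.indicator hCm.compl) (C := M) fun h => by
      by_cases hh : h ∈ Cᶜ
      · rw [Set.indicator_of_mem hh]; exact hKb h
      · rw [Set.indicator_of_notMem hh, abs_zero]; exact hM0
  rw [← integral_add i1 i2]
  refine integral_congr_ae (ae_of_all _ fun h => ?_)
  show transferKernel su2Rep β U (gaugeTransform (basedExt L h) V) =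
    C.indicator (fun _ => (1 : ℝ)) h * transferKernel su2Rep β U (gaugeTransform (basedExt L h) V) +
      Cᶜ.indicator (fun h => transferKernel su2Rep β U (gaugeTransform (basedExt L h) V)) h
  by_cases hh : h ∈ C
  · rw [Set.indicator_of_mem hh, Set.indicator_of_notMem (Set.notMem_compl_iff.mpr hh), one_mul, add_zero]
  · rw [Set.indicator_of_notMem hh, Set.indicator_of_mem (Set.mem_compl hh), zero_mul, zero_add]

/-- The based kernel is at most the kernel's sup: `∫ K(U,V^{bE h}) dh ≤ e^{2β|E|}` (`β ≥ 0`). [folklore] -/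
theorem basedIntegral_le_expCard {β : ℝ} (hβ : 0 ≤ β) (U V : GaugeConfig 3 L SU2) :
    ∫ h, transferKernel su2Rep β U (gaugeTransform (basedExt L h) V) ∂basedMeasure L ≤ Real.exp (β * (2 * (Fintype.card (Edge 3 L) : ℝ))) := by
  haveI : IsProbabilityMeasure (basedMeasure L) := by unfold basedMeasure; infer_instance
  have hpt : ∀ h : NzSite L → SU2, transferKernel su2Rep β U (gaugeTransform (basedExt L h) V) ≤ Real.exp (β * (2 * (Fintype.card (Edge 3 L) : ℝ))) := fun h => by
    have h1 := transferKernel_gaugeTransform_le hβ U V (basedExt L h)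
    exact h1.trans (Real.exp_le_exp.mpr (by linarith [mul_nonneg hβ (kinDefect_nonneg U V (basedExt L h))]))
  have h := integral_mono_of_nonneg (μ := basedMeasure L) (ae_of_all _ fun h => (transferKernel_pos su2Rep β _ _).le) (integrable_const _) (ae_of_all _ hpt)
  simpa [integral_const, probReal_univ, smul_eq_mul] using h

/-- The based kernel is nonnegative. [folklore] -/
theorem basedIntegral_nonneg (β : ℝ) (U V : GaugeConfig 3 L SU2) : 0 ≤ ∫ h, transferKernel su2Rep β U (gaugeTransform (basedExt L h) V) ∂basedMeasure L :=
  integral_nonneg fun _ => (transferKernel_pos su2Rep β _ _).le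

omit [NeZero L] in
/-- `ρ(u',u) = K₁(u',u)/K₁(1,1) ≤ e^{−L³β·‖q(u'_k) − q(u_k)‖²}` for every `k` (`β ≥ 0`); in particular `ρ ≤ 1`. [cite: Luscher1983, §3] -/
theorem rho_le_exp_neg {β : ℝ} (hβ : 0 ≤ β) (u' u : GaugeConfig 3 1 SU2) (k : Fin 3) :
    transferKernel su2Rep ((L : ℝ) ^ 3 * β) u' u / transferKernel su2Rep ((L : ℝ) ^ 3 * β) (1 : GaugeConfig 3 1 SU2) 1 ≤
      Real.exp (-((L : ℝ) ^ 3 * β * ‖su2Quat (u' (0, k)) - su2Quat (u (0, k))‖ ^ 2)) := by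
  have hB : 0 ≤ (L : ℝ) ^ 3 * β := by positivity
  rw [transferKernel_one_site_one_one, div_le_iff₀ (Real.exp_pos _), ← Real.exp_add]
  refine (transferKernel_one_site_le_exp hB u' u k).trans (Real.exp_le_exp.mpr (le_of_eq (by ring)))

/-! ## §2 ★★★ The pointwise near-product bound -/

set_option maxHeartbeats 800000 in
-- many real inequalities.
/-- ★★★ **THE `hnear` GLUE, β-POINTWISE** (see the module docstring). [cite: Luscher1983, §3] -/
theorem basedKernel_product_near {β : ℝ} (hβ : 0 ≤ β) (u' u : GaugeConfig 3 1 SU2) {v' v : Edge 3 L → Fin 3 → ℝ} (hv' : v' ∈ capBalancedSet L) (hv : v ∈ capBalancedSet L)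
    {δ α T R σ : ℝ} (hδu' : ∀ k : Fin 3, ‖su2Quat (u' (0, k)) - 1‖ ≤ δ) (hδu : ∀ k : Fin 3, ‖su2Quat (u (0, k)) - 1‖ ≤ δ) (hδ1 : δ ≤ 1 / 2)
    (hα0 : 0 ≤ α) (hα1 : α ≤ 1) (hT0 : 0 ≤ T) (hT : T ≤ 1 / 30) (hσ : σ < 2)
    (hS' : (L : ℝ) ^ 3 * wilsonAction su2Rep u' ≤ σ) (hS : (L : ℝ) ^ 3 * wilsonAction su2Rep u ≤ σ)
    (hv'T : ∀ (e : Edge 3 L) (c : Fin 3), |v' e c| ≤ T) (hx' : ‖linkEmbed L v'‖ ≤ R) (hvT : ∀ (e : Edge 3 L) (c : Fin 3), |v e c| ≤ T) (hx : ‖linkEmbed L v‖ ≤ R)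
    (hLa : 12 * L * (Real.sqrt 2 * R + δ) ≤ 1) (hTb : 2 * Real.sqrt 2 * R + α ≤ T / (6 * L))
    (hm0 : 0 ≤ L * (1 - (L - 1) * δ) * α - L * (Real.sqrt 2 * (R + R))) :
    |(∫ h, transferKernel su2Rep β (orthoTube L u' v') (gaugeTransform (basedExt L h) (orthoTube L u v)) ∂basedMeasure L) -
        (transferKernel su2Rep ((L : ℝ) ^ 3 * β) u' u / transferKernel su2Rep ((L : ℝ) ^ 3 * β) (1 : GaugeConfig 3 1 SU2) 1) *
          ∫ h, transferKernel su2Rep β (orthoTube L 1 v') (gaugeTransform (basedExt L h) (orthoTube L 1 v)) ∂basedMeasure L| ≤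
      (Real.exp (coreEta L β δ α T R (Fintype.card (Site 3 L) * T) σ + coreEps1 L β δ T R + coreEps2 L β δ T R σ) - 1) *
          ((transferKernel su2Rep ((L : ℝ) ^ 3 * β) u' u / transferKernel su2Rep ((L : ℝ) ^ 3 * β) (1 : GaugeConfig 3 1 SU2) 1) *
            ∫ h, transferKernel su2Rep β (orthoTube L 1 v') (gaugeTransform (basedExt L h) (orthoTube L 1 v)) ∂basedMeasure L) +
        Real.exp (β * (2 * (Fintype.card (Edge 3 L) : ℝ))) *
          (2 * Real.exp (-(β * (T / (6 * L) - (2 * Real.sqrt 2 * R + α)) ^ 2)) + Real.exp (-(β * ((L * (1 - (L - 1) * δ) * α - L * (Real.sqrt 2 * (R + R))) ^ 2 / L))) +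
            Real.exp (-((L : ℝ) ^ 3 * β * α ^ 2))) := by
  haveI : IsProbabilityMeasure (basedMeasure L) := by unfold basedMeasure; infer_instance
  -- names
  set G : ℝ := ∫ h, transferKernel su2Rep β (orthoTube L u' v') (gaugeTransform (basedExt L h) (orthoTube L u v)) ∂basedMeasure L with hGdef
  set G₁ : ℝ := ∫ h, transferKernel su2Rep β (orthoTube L 1 v') (gaugeTransform (basedExt L h) (orthoTube L 1 v)) ∂basedMeasure L with hG₁def
  set ρ : ℝ := transferKernel su2Rep ((L : ℝ) ^ 3 * β) u' u / transferKernel su2Rep ((L : ℝ) ^ 3 * β) (1 : GaugeConfig 3 1 SU2) 1 with hρdef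
  set η : ℝ := coreEta L β δ α T R (Fintype.card (Site 3 L) * T) σ + coreEps1 L β δ T R + coreEps2 L β δ T R σ with hηdef
  set EK : ℝ := Real.exp (β * (2 * (Fintype.card (Edge 3 L) : ℝ))) with hEK
  set b : ℝ := 2 * Real.sqrt 2 * R + α with hbdef
  set tnear : ℝ := Real.exp (-(β * (T / (6 * L) - b) ^ 2)) with htnear
  set m₀ : ℝ := L * (1 - (L - 1) * δ) * α - L * (Real.sqrt 2 * (R + R)) with hm₀
  set tfar : ℝ := Real.exp (-(β * (m₀ ^ 2 / L))) with htfar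
  set tρ : ℝ := Real.exp (-((L : ℝ) ^ 3 * β * α ^ 2)) with htρ
  -- basic signs and sizes
  have hL1 : (1 : ℝ) ≤ L := by exact_mod_cast NeZero.one_le
  have hL0 : (0 : ℝ) < L := by linarith
  have hδ0 : 0 ≤ δ := (norm_nonneg _).trans (hδu 0)
  have hR0 : 0 ≤ R := (norm_nonneg _).trans hx
  have hσ0 : 0 ≤ σ := le_trans (mul_nonneg (by positivity) (wilsonAction_su2_nonneg_lat u)) hS
  have hρ0 : 0 < ρ := div_pos (transferKernel_pos _ _ _ _) (transferKernel_pos _ _ _ _)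
  have hρ1 : ρ ≤ 1 := by
    have h := rho_le_exp_neg (L := L) hβ u' u 0
    exact h.trans (Real.exp_le_one_iff.mpr (neg_nonpos.mpr (by positivity)))
  have hG0 : 0 ≤ G := basedIntegral_nonneg β _ _
  have hG₁0 : 0 ≤ G₁ := basedIntegral_nonneg β _ _
  have hG₁E : G₁ ≤ EK := basedIntegral_le_expCard hβ _ _
  have hEK0 : 0 ≤ EK := (Real.exp_pos _).le
  have hη0 : 0 ≤ η := by
    have h1 : 0 ≤ coreEta L β δ α T R (Fintype.card (Site 3 L) * T) σ := by
      have := Cov.stepActionErr_nonneg (L := L) (σ := σ) hT0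
      unfold coreEta; positivity
    have h2 : 0 ≤ coreEps1 L β δ T R := by unfold coreEps1; positivity
    have h3 : 0 ≤ coreEps2 L β δ T R σ := by
      have := Cov.stepActionErr_nonneg (L := L) (σ := σ) hT0
      have := Cov.stepActionErr_nonneg (L := L) (σ := 0) hT0
      unfold coreEps2; positivity
    rw [hηdef]; exact add_nonneg (add_nonneg h1 h2) h3
  have heη : 0 ≤ Real.exp η - 1 := by linarith [Real.add_one_le_exp η]
  have heη1 : 1 - Real.exp (-η) ≤ Real.exp η - 1 := by
    have h1 := Real.add_one_le_exp (-η)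
    have h2 := Real.add_one_le_exp η
    linarith
  have htn0 : 0 ≤ tnear := (Real.exp_pos _).le
  have htf0 : 0 ≤ tfar := (Real.exp_pos _).le
  have htρ0 : 0 ≤ tρ := (Real.exp_pos _).le
  have hηρG₁ : 0 ≤ (Real.exp η - 1) * (ρ * G₁) := mul_nonneg heη (mul_nonneg hρ0.le hG₁0)
  -- tube-link bounds
  have hv1 : ∀ e : Edge 3 L, ∑ a, v e a ^ 2 ≤ 1 := sum_sq_le_one_of_cap L hv.2
  have hv'1 : ∀ e : Edge 3 L, ∑ a, v' e a ^ 2 ≤ 1 := sum_sq_le_one_of_cap L hv'.2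
  have h1e : ∀ e : Edge 3 L, su2Quat ((1 : GaugeConfig 3 1 SU2) (0, e.2)) = 1 := fun e => by rw [Pi.one_apply]; exact su2Quat_one
  by_cases hnear : ∀ k : Fin 3, ‖su2Quat (u' (0, k)) - su2Quat (u (0, k))‖ ≤ α
  · -- NEAR PAIR
    set C := {h : NzSite L → SU2 | ∀ y, ‖su2Quat (h y) - 1‖ ≤ T} with hC
    set GT : ℝ := ∫ h, C.indicator (fun _ => (1 : ℝ)) h * transferKernel su2Rep β (orthoTube L u' v') (gaugeTransform (basedExt L h) (orthoTube L u v)) ∂basedMeasure L with hGT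
    set Goff : ℝ := ∫ h, Cᶜ.indicator (fun h => transferKernel su2Rep β (orthoTube L u' v') (gaugeTransform (basedExt L h) (orthoTube L u v))) h ∂basedMeasure L with hGoff
    set G₁T : ℝ := ∫ h, C.indicator (fun _ => (1 : ℝ)) h * transferKernel su2Rep β (orthoTube L 1 v') (gaugeTransform (basedExt L h) (orthoTube L 1 v)) ∂basedMeasure L with hG₁T
    set G₁off : ℝ := ∫ h, Cᶜ.indicator (fun h => transferKernel su2Rep β (orthoTube L 1 v') (gaugeTransform (basedExt L h) (orthoTube L 1 v))) h ∂basedMeasure L with hG₁off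
    have hsplit : G = GT + Goff := basedIntegral_split (L := L) β T _ _
    have hsplit₁ : G₁ = G₁T + G₁off := basedIntegral_split (L := L) β T _ _
    have hG₁off0 : 0 ≤ G₁off := integral_nonneg fun h => Set.indicator_nonneg (fun _ _ => (transferKernel_pos su2Rep β _ _).le) _
    have hGoff0 : 0 ≤ Goff := integral_nonneg fun h => Set.indicator_nonneg (fun _ _ => (transferKernel_pos su2Rep β _ _).le) _
    have hG₁T0 : 0 ≤ G₁T := integral_nonneg fun h => mul_nonneg (Set.indicator_nonneg (fun _ _ => zero_le_one) _) (transferKernel_pos su2Rep β _ _).le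
    -- the two-sided core transport
    obtain ⟨hlo, hhi⟩ := basedKernel_core_two_sided (L := L) hβ u' u hv' hv hδu' hδ1 hnear hα1 hT0 hT hσ hS' hS hv'T hx' hvT hx
    -- off-core tails
    have ha' : ∀ e : Edge 3 L, ‖su2Quat (orthoTube L u' v' e) - 1‖ ≤ Real.sqrt 2 * R + δ := fun e => by
      have h := norm_su2Quat_orthoTube_sub_one_le u' hv'1 e
      have := mul_le_mul_of_nonneg_left hx' (Real.sqrt_nonneg 2)
      linarith [hδu' e.2]
    have hb' : ∀ e : Edge 3 L, ‖su2Quat (orthoTube L u' v' e) - su2Quat (orthoTube L u v e)‖ ≤ b := fun e => by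
      have h := norm_su2Quat_orthoTube_sub_orthoTube_le u' u hv'1 hv1 e
      have h1 := mul_le_mul_of_nonneg_left hx' (Real.sqrt_nonneg 2)
      have h2 := mul_le_mul_of_nonneg_left hx (Real.sqrt_nonneg 2)
      rw [hbdef]; linarith [hnear e.2]
    have ha₁ : ∀ e : Edge 3 L, ‖su2Quat (orthoTube L 1 v' e) - 1‖ ≤ Real.sqrt 2 * R + δ := fun e => by
      have h := norm_su2Quat_orthoTube_sub_le (1 : GaugeConfig 3 1 SU2) hv'1 e
      rw [h1e] at h
      have := mul_le_mul_of_nonneg_left hx' (Real.sqrt_nonneg 2)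
      linarith
    have hb₁ : ∀ e : Edge 3 L, ‖su2Quat (orthoTube L 1 v' e) - su2Quat (orthoTube L 1 v e)‖ ≤ b := fun e => by
      have h := norm_su2Quat_orthoTube_sub_orthoTube_le (1 : GaugeConfig 3 1 SU2) 1 hv'1 hv1 e
      rw [sub_self, norm_zero, add_zero] at h
      have h1 := mul_le_mul_of_nonneg_left hx' (Real.sqrt_nonneg 2)
      have h2 := mul_le_mul_of_nonneg_left hx (Real.sqrt_nonneg 2)
      rw [hbdef]; linarith
    have hGoff_le : Goff ≤ EK * tnear := integral_basedKernel_off_core_le hβ _ _ ha' hb' hLa hTb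
    have hG₁off_le : G₁off ≤ EK * tnear := integral_basedKernel_off_core_le hβ _ _ ha₁ hb₁ hLa hTb
    -- algebra with the atoms `P = ρ·G₁T`, `Q = ρ·G₁off`
    set P : ℝ := ρ * G₁T with hPdef
    set Q : ℝ := ρ * G₁off with hQdef
    have hP0 : 0 ≤ P := mul_nonneg hρ0.le hG₁T0
    have hQ0 : 0 ≤ Q := mul_nonneg hρ0.le hG₁off0
    have hρG₁ : ρ * G₁ = P + Q := by rw [hsplit₁, hPdef, hQdef]; ring
    have hhi' : GT ≤ Real.exp η * P := by rw [hPdef, ← mul_assoc]; exact hhi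
    have hlo' : Real.exp (-η) * P ≤ GT := by rw [hPdef, ← mul_assoc]; exact hlo
    have e1 : (Real.exp η - 1) * (ρ * G₁) = Real.exp η * P - P + (Real.exp η - 1) * Q := by rw [hρG₁]; ring
    have e2 : (1 - Real.exp (-η)) * P = P - Real.exp (-η) * P := by ring
    have t1 : 0 ≤ (Real.exp η - 1) * Q := mul_nonneg heη hQ0
    have t2 : (1 - Real.exp (-η)) * P ≤ (Real.exp η - 1) * P := mul_le_mul_of_nonneg_right heη1 hP0
    have e3 : (Real.exp η - 1) * P = Real.exp η * P - P := by ring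
    have hQle : Q ≤ EK * tnear := by
      rw [hQdef]
      calc ρ * G₁off ≤ 1 * (EK * tnear) := mul_le_mul hρ1 hG₁off_le hG₁off0 zero_le_one
        _ = EK * tnear := one_mul _
    have hup : G - ρ * G₁ ≤ (Real.exp η - 1) * (ρ * G₁) + Goff := by linarith [hsplit, hρG₁, e1, hhi', t1]
    have hdown : ρ * G₁ - G ≤ (Real.exp η - 1) * (ρ * G₁) + Q := by linarith [hsplit, hρG₁, e1, hlo', t1, t2, e2, e3]
    have habs : |G - ρ * G₁| ≤ (Real.exp η - 1) * (ρ * G₁) + (Goff + Q) := by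
      rw [abs_le]; constructor <;> linarith
    calc |G - ρ * G₁| ≤ (Real.exp η - 1) * (ρ * G₁) + (Goff + Q) := habs
      _ ≤ (Real.exp η - 1) * (ρ * G₁) + EK * (2 * tnear) := by linarith
      _ ≤ (Real.exp η - 1) * (ρ * G₁) + EK * (2 * tnear + tfar + tρ) := by
          have : EK * (2 * tnear) ≤ EK * (2 * tnear + tfar + tρ) := mul_le_mul_of_nonneg_left (by linarith) hEK0
          linarith
  · -- FAR PAIR
    push Not at hnear
    obtain ⟨k, hk⟩ := hnear
    -- the whole based kernel is small
    have hcoef : 0 ≤ (L : ℝ) * (1 - (L - 1) * δ) := by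
      refine mul_nonneg hL0.le ?_
      have h12 : 12 * (L : ℝ) * δ ≤ 1 := by
        have : 12 * (L : ℝ) * (Real.sqrt 2 * R) ≥ 0 := by positivity
        nlinarith
      nlinarith
    have hm_ge : m₀ ≤ L * (1 - (L - 1) * δ) * ‖su2Quat (u' (0, k)) - su2Quat (u (0, k))‖ - L * (Real.sqrt 2 * (‖linkEmbed L v'‖ + ‖linkEmbed L v‖)) := by
      rw [hm₀]
      have h1 := mul_le_mul_of_nonneg_left hk.le hcoef
      have h2 : (L : ℝ) * (Real.sqrt 2 * (‖linkEmbed L v'‖ + ‖linkEmbed L v‖)) ≤ L * (Real.sqrt 2 * (R + R)) :=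
        mul_le_mul_of_nonneg_left (mul_le_mul_of_nonneg_left (add_le_add hx' hx) (Real.sqrt_nonneg 2)) hL0.le
      linarith
    have hm' : 0 ≤ L * (1 - (L - 1) * δ) * ‖su2Quat (u' (0, k)) - su2Quat (u (0, k))‖ - L * (Real.sqrt 2 * (‖linkEmbed L v'‖ + ‖linkEmbed L v‖)) := hm0.trans hm_ge
    have hGfar := integral_basedKernel_far_le (L := L) hβ u' u hv' hv k (hδu' k) (hδu k) hm'
    have hG_le : G ≤ EK * tfar := by
      refine hGfar.trans (mul_le_mul_of_nonneg_left (Real.exp_le_exp.mpr ?_) hEK0)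
      have hsq := pow_le_pow_left₀ hm0 hm_ge 2
      have h := mul_le_mul_of_nonneg_left (div_le_div_of_nonneg_right hsq hL0.le) hβ
      linarith
    -- `ρ` is small
    have hρfar : ρ ≤ tρ := by
      refine (rho_le_exp_neg (L := L) hβ u' u k).trans (Real.exp_le_exp.mpr ?_)
      have hsq : α ^ 2 ≤ ‖su2Quat (u' (0, k)) - su2Quat (u (0, k))‖ ^ 2 := pow_le_pow_left₀ hα0 hk.le 2
      have := mul_le_mul_of_nonneg_left hsq (by positivity : (0 : ℝ) ≤ (L : ℝ) ^ 3 * β)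
      linarith
    have hρG₁0 : 0 ≤ ρ * G₁ := mul_nonneg hρ0.le hG₁0
    have habs : |G - ρ * G₁| ≤ G + ρ * G₁ := by
      rw [abs_le]; constructor <;> linarith
    have hρG₁ : ρ * G₁ ≤ tρ * EK := mul_le_mul hρfar hG₁E hG₁0 htρ0
    calc |G - ρ * G₁| ≤ G + ρ * G₁ := habs
      _ ≤ EK * tfar + tρ * EK := add_le_add hG_le hρG₁
      _ = EK * (tfar + tρ) := by ring
      _ ≤ (Real.exp η - 1) * (ρ * G₁) + EK * (2 * tnear + tfar + tρ) := by
          have : EK * (tfar + tρ) ≤ EK * (2 * tnear + tfar + tρ) := mul_le_mul_of_nonneg_left (by linarith) hEK0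
          linarith

end Summit.QuantumFields.YangMills.Theorems.FemtoTransferGap.TwoLattice.ConstTube

end
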